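import Literature.Probability.RandomPlanarGeometry.SAWTriangularBridges
import HarnessLib

/-!
# Bridges of the triangular lattice in the list model, and the detour surgery restricted to bridges

Topic `Literature/Probability/RandomPlanarGeometry` (lane «pcv-sawmu», door C4 «TRI-BRIDGE-RATIO»:
`b_{N+1}(𝕋)/b_N(𝕋) → μ(𝕋)`). Sources: N. Madras, G. Slade, *The Self-Avoiding Walk* (1993), Definition 1.2.4
(bridges), §7.3, proof of Theorem 7.3.2 (the transfer `(ω, site) ↦ (ω', site)` counted in two ways,
(7.3.5)–(7.3.7)) and Theorem 7.3.4(d) ("`lim b_{N+1}/b_N = μ`", printed for `ℤ^d` via renewal theory,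
pp. 248–249); on `𝕋` the one-step detour surgery of `SAWTriangularDetourSurgery.lean` (insert / delete the apex
of a tight triangle) acts on BRIDGES directly, which is what this file sets up.

## Contents (namespace `Literature.Probability.RandomPlanarGeometry.SAW`)

* `triHgt ω j = X(ω_j)` (brick height `2x₀ + x₁` of the `j`-th vertex), `IsTriBridgeList N ω`
  (`X(ω₀) < X(ω_i) ≤ X(ω_N)`, `1 ≤ i ≤ N`), **`triBL N`** = the `N`-step bridges of `𝕋` as vertex lists,
  `card_triBL : #(triBL N) = brickBridgeCount N` (the vertex-function count of `SAWTriangularBridges.lean`,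
  so `b_N ≤ μ^N`, `e^{−15√N} μ^N ≤ b_N`, `b_N^{1/N} → μ(𝕋)` apply);
* `triBSlots ω` — the detour slots `(m, z)` of `ω` whose apex height lies in `(X(ω₀), X(ω_last)]`
  (exactly the insertions that keep a bridge a bridge); deletions of sharp-turn apexes ALWAYS keep a
  bridge a bridge (the endpoints are never deleted);
* surgery laws `triIns_mem_triBL`, `triDel_mem_triBL`, `mem_triBSlots_triDel`, the pair bijection
  **`sum_triBSlotPairs_eq_sum_triSharpBPairs`** (slot pairs of `B_N` ≅ sharp-turn pairs of `B_{N+1}`),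
  `sum_triBSlotPairs`, `sum_triSharpBPairs`;
* bookkeeping: `card_triBSlots_le` (`I_B ≤ 2N`), `one_le_card_triSharp_triIns_of_triBL`,
  `card_triBSlots_le_triIns` (`I_B(ω) ≤ I_B(ω') + 8`); the `J`-bounds are the all-walk ones
  (`card_triSharp_triIns_le`, `card_triSharp_le_triIns`);
* `brickBridgeCount_le_succ : b_N(𝕋) ≤ b_{N+1}(𝕋)` (`b_1 b_N ≤ b_{N+1}`).
-/

noncomputable section

open Finset Function Literature.Probability.LatticeModels Literature.Probability.Percolation SimpleGraph
open scoped BigOperators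

namespace Literature.Probability.RandomPlanarGeometry.SAW

/-! ### Bridges of `𝕋` as vertex lists -/

/-- The brick height `X = 2x₀ + x₁` of the `j`-th vertex of a vertex list (junk `0` beyond the end).
[cite: Grimmett2018, §5.5] -/
def triHgt (ω : List (Site 2)) (j : ℕ) : ℤ := 2 * (ω.getD j 0) 0 + (ω.getD j 0) 1

/-- `triHgt` is the first brick coordinate of the vertex. [cite: Grimmett2018, §5.5] -/
theorem triHgt_eq (ω : List (Site 2)) (j : ℕ) : triHgt ω j = toBrick (ω.getD j 0) 0 := rfl

/-- **Bridge** (as a vertex list of `𝕋`, brick height): `X(ω₀) < X(ω_i) ≤ X(ω_N)` for `1 ≤ i ≤ N`.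
[cite: MadrasSlade1993, Definition 1.2.4] -/
def IsTriBridgeList (N : ℕ) (ω : List (Site 2)) : Prop :=
  ∀ i ∈ Finset.Icc 1 N, triHgt ω 0 < triHgt ω i ∧ triHgt ω i ≤ triHgt ω N

/-- The bridge predicate is decidable. [cite: MadrasSlade1993, Definition 1.2.4] -/
instance (N : ℕ) : DecidablePred (IsTriBridgeList N) := fun _ => by
  unfold IsTriBridgeList; infer_instance

/-- **`B_N(𝕋)`**: the `N`-step bridges of the triangular lattice from `0`, as vertex lists.
[cite: MadrasSlade1993, Definition 1.2.4] -/
def triBL (N : ℕ) : Finset (List (Site 2)) := (triSL N).filter (IsTriBridgeList N)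

variable {N : ℕ} {ω : List (Site 2)} {m j : ℕ} {z : Site 2}

/-- Membership in `triBL`. [cite: MadrasSlade1993, Definition 1.2.4] -/
theorem mem_triBL : ω ∈ triBL N ↔ ω ∈ triSL N ∧ IsTriBridgeList N ω := Finset.mem_filter

/-- A bridge is a self-avoiding walk. [cite: MadrasSlade1993, Definition 1.2.4] -/
theorem triSL_of_mem_triBL (h : ω ∈ triBL N) : ω ∈ triSL N := (mem_triBL.1 h).1

/-- The bridge inequalities, unfolded. [cite: MadrasSlade1993, Definition 1.2.4] -/
theorem hgt_of_mem_triBL (h : ω ∈ triBL N) {i : ℕ} (h1 : 1 ≤ i) (h2 : i ≤ N) :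
    triHgt ω 0 < triHgt ω i ∧ triHgt ω i ≤ triHgt ω N :=
  (mem_triBL.1 h).2 i (Finset.mem_Icc.2 ⟨h1, h2⟩)

/-- Heights of the vertex function `brickFun N l`. [cite: Grimmett2018, §5.5] -/
theorem brickFun_apply_zero (N : ℕ) (l : List (Site 2)) (i : ℕ) : brickFun N l i 0 = triHgt l (min i N) := by
  rw [brickFun_apply, toBrick_apply_zero, triHgt]

/-- The vertex function of a list is a bridge (tree predicate `Zd.IsBridge`) iff the list is.
[cite: MadrasSlade1993, Definition 1.2.4] -/
theorem isBridge_brickFun_iff (N : ℕ) (l : List (Site 2)) : Zd.IsBridge N (brickFun N l) ↔ IsTriBridgeList N l := by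
  constructor
  · intro h i hi
    rw [Finset.mem_Icc] at hi
    have := h i hi.1 hi.2
    rwa [brickFun_apply_zero, brickFun_apply_zero, brickFun_apply_zero, Nat.zero_min, min_eq_left hi.2,
      min_self] at this
  · intro h i h1 h2
    have := h i (Finset.mem_Icc.2 ⟨h1, h2⟩)
    rwa [brickFun_apply_zero, brickFun_apply_zero, brickFun_apply_zero, Nat.zero_min, min_eq_left h2, min_self]

open Classical in
/-- The vertex-function bridges are the images of the list bridges. [cite: MadrasSlade1993, Definition 1.2.4] -/
theorem brickBridges_eq_image (N : ℕ) : brickBridges N = (triBL N).image (brickFun N) := by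
  classical
  ext f
  rw [mem_brickBridges, brickSaws, Finset.mem_image, Finset.mem_image]
  constructor
  · rintro ⟨⟨l, hl, rfl⟩, hb⟩
    exact ⟨l, mem_triBL.2 ⟨hl, (isBridge_brickFun_iff N l).1 hb⟩, rfl⟩
  · rintro ⟨l, hl, rfl⟩
    obtain ⟨hl, hb⟩ := mem_triBL.1 hl
    exact ⟨⟨l, hl, rfl⟩, (isBridge_brickFun_iff N l).2 hb⟩

/-- **`#B_N(𝕋) = b_N(𝕋)`** (the count `brickBridgeCount` of `SAWTriangularBridges.lean`).
[cite: MadrasSlade1993, Definition 1.2.4] -/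
theorem card_triBL (N : ℕ) : #(triBL N) = brickBridgeCount N := by
  classical
  rw [brickBridgeCount, brickBridges_eq_image, Finset.card_image_of_injOn]
  exact (brickFun_injOn N).mono (by intro l hl; exact Finset.mem_coe.2 (triSL_of_mem_triBL (Finset.mem_coe.1 hl)))

/-- `1 ≤ b_N(𝕋)`, list form. [cite: MadrasSlade1993, §1.2] -/
theorem one_le_card_triBL (N : ℕ) : 1 ≤ #(triBL N) := by
  rw [card_triBL]; exact one_le_brickBridgeCount N

/-! ### The slots that keep a bridge a bridge -/

/-- The **bridge slots** of `ω`: detour slots `(m, z)` whose apex height lies in `(X(ω₀), X(ω_last)]`.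
[cite: MadrasSlade1993, §7.3 (proof of Theorem 7.3.2)] -/
def triBSlots (ω : List (Site 2)) : Finset (ℕ × Site 2) :=
  (triSlots ω).filter fun p => triHgt ω 0 < 2 * p.2 0 + p.2 1 ∧ 2 * p.2 0 + p.2 1 ≤ triHgt ω (ω.length - 1)

/-- Membership in `triBSlots`. [cite: MadrasSlade1993, §7.3] -/
theorem mem_triBSlots {p : ℕ × Site 2} : p ∈ triBSlots ω ↔
    p ∈ triSlots ω ∧ triHgt ω 0 < 2 * p.2 0 + p.2 1 ∧ 2 * p.2 0 + p.2 1 ≤ triHgt ω (ω.length - 1) := by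
  rw [triBSlots, mem_filter]

/-- Bridge slots are slots. [cite: MadrasSlade1993, §7.3] -/
theorem triBSlots_subset (ω : List (Site 2)) : triBSlots ω ⊆ triSlots ω := filter_subset _ _

/-- `I_B(ω) ≤ I(ω) ≤ 2N`. [cite: MadrasSlade1993, §7.3 (proof of Theorem 7.3.2)] -/
theorem card_triBSlots_le (hω : ω ∈ triBL N) : #(triBSlots ω) ≤ 2 * N :=
  (card_le_card (triBSlots_subset ω)).trans (card_triSlots_le (triSL_of_mem_triBL hω))

/-! ### Heights after insertion and deletion -/

/-- Height of a vertex of `triIns m z ω` before the insertion point. [cite: MadrasSlade1993, §7.3] -/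
theorem triHgt_triIns_of_le (hj : j ≤ m) : triHgt (triIns m z ω) j = triHgt ω j := by
  rw [triHgt, triHgt, getD_triIns_of_le hj]

/-- Height of the inserted vertex. [cite: MadrasSlade1993, §7.3] -/
theorem triHgt_triIns_self (hm : m + 1 ≤ ω.length) : triHgt (triIns m z ω) (m + 1) = 2 * z 0 + z 1 := by
  rw [triHgt, getD_triIns_self hm]

/-- Height of a vertex of `triIns m z ω` after the insertion point. [cite: MadrasSlade1993, §7.3] -/
theorem triHgt_triIns_of_lt (hj : m + 1 < j) : triHgt (triIns m z ω) j = triHgt ω (j - 1) := by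
  rw [triHgt, triHgt, getD_triIns_of_lt hj]

/-- Height of a vertex of `triDel m ω` before the deletion point. [cite: MadrasSlade1993, §7.3] -/
theorem triHgt_triDel_of_le (hj : j ≤ m) : triHgt (triDel m ω) j = triHgt ω j := by
  rw [triHgt, triHgt, getD_triDel_of_le hj]

/-- Height of a vertex of `triDel m ω` after the deletion point. [cite: MadrasSlade1993, §7.3] -/
theorem triHgt_triDel_of_lt (hj : m < j) : triHgt (triDel m ω) j = triHgt ω (j + 1) := by
  rw [triHgt, triHgt, getD_triDel_of_lt hj]

/-! ### The surgery maps `B_N`-slots to `B_{N+1}`-sharp turns and back -/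

/-- Inserting an apex of admissible height into a bridge gives a bridge (the endpoints and hence the
height range are unchanged). [cite: MadrasSlade1993, §7.3 (proof of Theorem 7.3.2)] -/
theorem triIns_mem_triBL (hω : ω ∈ triBL N) (hs : (m, z) ∈ triBSlots ω) : triIns m z ω ∈ triBL (N + 1) := by
  obtain ⟨hs, hlo, hhi⟩ := mem_triBSlots.1 hs
  obtain ⟨hm, -, -, -⟩ := mem_triSlots.1 hs
  have hωS := triSL_of_mem_triBL hω
  have hl := length_of_mem_triSL hωS
  rw [hl, Nat.add_sub_cancel] at hhi
  dsimp only at hlo hhi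
  refine mem_triBL.2 ⟨triIns_mem_triSL hωS hs, fun i hi => ?_⟩
  rw [Finset.mem_Icc] at hi
  rw [triHgt_triIns_of_le (Nat.zero_le m), triHgt_triIns_of_lt (by omega : m + 1 < N + 1), Nat.add_sub_cancel]
  rcases Nat.lt_trichotomy i (m + 1) with hlt | heq | hgt
  · rw [triHgt_triIns_of_le (by omega)]
    exact hgt_of_mem_triBL hω hi.1 (by omega)
  · rw [heq, triHgt_triIns_self (by omega)]
    exact ⟨hlo, hhi⟩
  · rw [triHgt_triIns_of_lt hgt]
    exact hgt_of_mem_triBL hω (by omega) (by omega)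

/-- Deleting the apex of a sharp turn of a bridge gives a bridge (an interior vertex is removed; the
endpoints stay). [cite: MadrasSlade1993, §7.3 (proof of Theorem 7.3.2)] -/
theorem triDel_mem_triBL (hω : ω ∈ triBL (N + 1)) (hm : m ∈ triSharp ω) : triDel m ω ∈ triBL N := by
  obtain ⟨hml, -⟩ := mem_triSharp.1 hm
  have hωS := triSL_of_mem_triBL hω
  have hl := length_of_mem_triSL hωS
  refine mem_triBL.2 ⟨triDel_mem_triSL hωS hm, fun i hi => ?_⟩
  rw [Finset.mem_Icc] at hi
  rw [triHgt_triDel_of_le (Nat.zero_le m), triHgt_triDel_of_lt (by omega : m < N)]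
  rcases le_or_gt i m with hle | hgt
  · rw [triHgt_triDel_of_le hle]
    exact hgt_of_mem_triBL hω hi.1 (by omega)
  · rw [triHgt_triDel_of_lt hgt]
    exact hgt_of_mem_triBL hω (by omega) (by omega)

/-- After the deletion, the deleted apex is a bridge slot of the contracted bridge (its height was in
range, and the range is unchanged). [cite: MadrasSlade1993, §7.3 (proof of Theorem 7.3.2)] -/
theorem mem_triBSlots_triDel (hω : ω ∈ triBL (N + 1)) (hm : m ∈ triSharp ω) :
    (m, ω.getD (m + 1) 0) ∈ triBSlots (triDel m ω) := by
  obtain ⟨hml, -⟩ := mem_triSharp.1 hm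
  have hωS := triSL_of_mem_triBL hω
  have hl := length_of_mem_triSL hωS
  have hr := hgt_of_mem_triBL hω (show 1 ≤ m + 1 by omega) (show m + 1 ≤ N + 1 by omega)
  have hlen : (triDel m ω).length - 1 = N := by rw [length_triDel (by omega), hl]; rfl
  refine mem_triBSlots.2 ⟨mem_triSlots_triDel hωS hm, ?_, ?_⟩
  · show triHgt (triDel m ω) 0 < triHgt ω (m + 1)
    rw [triHgt_triDel_of_le (Nat.zero_le m)]
    exact hr.1
  · show triHgt ω (m + 1) ≤ triHgt (triDel m ω) ((triDel m ω).length - 1)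
    rw [hlen, triHgt_triDel_of_lt (by omega : m < N)]
    exact hr.2

/-! ### Counting the bridge pairs in two ways -/

/-- The bridge slot pairs `(ω, (m, z))`, `ω ∈ B_N`, `(m, z)` a bridge slot of `ω`.
[cite: MadrasSlade1993, §7.3 (proof of Theorem 7.3.2), (7.3.5)] -/
def triBSlotPairs (N : ℕ) : Finset (Σ _ : List (Site 2), ℕ × Site 2) := (triBL N).sigma fun ω => triBSlots ω

/-- The bridge sharp-turn pairs `(ω, m)`, `ω ∈ B_N`, `m` a sharp turn of `ω`.
[cite: MadrasSlade1993, §7.3 (proof of Theorem 7.3.2), (7.3.5)] -/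
def triSharpBPairs (N : ℕ) : Finset (Σ _ : List (Site 2), ℕ) := (triBL N).sigma fun ω => triSharp ω

/-- Summing over bridge slot pairs is summing `I_B(ω) · F(ω)` over bridges. [cite: MadrasSlade1993, §7.3] -/
theorem sum_triBSlotPairs (N : ℕ) (F : List (Site 2) → ℝ) :
    ∑ p ∈ triBSlotPairs N, F p.1 = ∑ ω ∈ triBL N, (#(triBSlots ω) : ℝ) * F ω := by
  rw [triBSlotPairs, Finset.sum_sigma]
  refine sum_congr rfl fun ω _ => ?_
  change ∑ s ∈ triBSlots ω, F ω = _
  rw [sum_const, nsmul_eq_mul]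

/-- Summing over bridge sharp-turn pairs is summing `J(ω) · F(ω)` over bridges. [cite: MadrasSlade1993, §7.3] -/
theorem sum_triSharpBPairs (N : ℕ) (F : List (Site 2) → ℝ) :
    ∑ q ∈ triSharpBPairs N, F q.1 = ∑ ω ∈ triBL N, (#(triSharp ω) : ℝ) * F ω := by
  rw [triSharpBPairs, Finset.sum_sigma]
  refine sum_congr rfl fun ω _ => ?_
  change ∑ s ∈ triSharp ω, F ω = _
  rw [sum_const, nsmul_eq_mul]

/-- **Counting the bridge pairs in two ways**: `(ω, (m, z)) ↦ (triIns m z ω, m)` is a bijection from the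
bridge slot pairs of `B_N` onto the sharp-turn pairs of `B_{N+1}` (inverse `(ω', m) ↦ (triDel m ω', (m, ω'_{m+1}))`).
[cite: MadrasSlade1993, §7.3 (proof of Theorem 7.3.2), (7.3.5)–(7.3.6)] -/
theorem sum_triBSlotPairs_eq_sum_triSharpBPairs (N : ℕ) (F : (Σ _ : List (Site 2), ℕ × Site 2) → ℝ)
    (G : (Σ _ : List (Site 2), ℕ) → ℝ)
    (h : ∀ p ∈ triBSlotPairs N, F p = G ⟨triIns p.2.1 p.2.2 p.1, p.2.1⟩) :
    ∑ p ∈ triBSlotPairs N, F p = ∑ q ∈ triSharpBPairs (N + 1), G q := by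
  refine Finset.sum_nbij' (fun p => ⟨triIns p.2.1 p.2.2 p.1, p.2.1⟩)
    (fun q => ⟨triDel q.2 q.1, (q.2, q.1.getD (q.2 + 1) 0)⟩) ?_ ?_ ?_ ?_ h
  · rintro ⟨ω, m, z⟩ hp
    rw [triBSlotPairs, Finset.mem_sigma] at hp
    rw [triSharpBPairs, Finset.mem_sigma]
    exact ⟨triIns_mem_triBL hp.1 hp.2,
      mem_triSharp_triIns (triSL_of_mem_triBL hp.1) (triBSlots_subset _ hp.2)⟩
  · rintro ⟨ω, m⟩ hq
    rw [triSharpBPairs, Finset.mem_sigma] at hq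
    rw [triBSlotPairs, Finset.mem_sigma]
    exact ⟨triDel_mem_triBL hq.1 hq.2, mem_triBSlots_triDel hq.1 hq.2⟩
  · rintro ⟨ω, m, z⟩ hp
    rw [triBSlotPairs, Finset.mem_sigma] at hp
    dsimp only at hp
    obtain ⟨hm, -, -, -⟩ := mem_triSlots.1 (triBSlots_subset _ hp.2)
    dsimp only
    rw [triDel_triIns, getD_triIns_self (by omega)]
  · rintro ⟨ω, m⟩ hq
    rw [triSharpBPairs, Finset.mem_sigma] at hq
    dsimp only at hq
    obtain ⟨hml, -⟩ := mem_triSharp.1 hq.2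
    dsimp only
    rw [triIns_triDel (by omega)]

/-! ### Bookkeeping for bridges -/

/-- After an admissible insertion the new bridge has a sharp turn: `1 ≤ J(ω')`. [cite: MadrasSlade1993, §7.3] -/
theorem one_le_card_triSharp_triIns_of_triBL (hω : ω ∈ triBL N) (hs : (m, z) ∈ triBSlots ω) :
    1 ≤ #(triSharp (triIns m z ω)) :=
  one_le_card_triSharp_triIns (triSL_of_mem_triBL hω) (triBSlots_subset _ hs)

/-- **`I_B(ω) ≤ I_B(ω') + 8`**: a bridge slot `(j, u)` of `ω` with `j ≠ m`, `u ≠ z` is (shifted) a bridge slot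
of `ω' = triIns m z ω` (same apex height, same height range); the others number at most `2 + 6`.
[cite: MadrasSlade1993, §7.3 (proof of Theorem 7.3.2)] -/
theorem card_triBSlots_le_triIns (hω : ω ∈ triBL N) (hs : (m, z) ∈ triBSlots ω) :
    #(triBSlots ω) ≤ #(triBSlots (triIns m z ω)) + 8 := by
  have hωS := triSL_of_mem_triBL hω
  have hs' := triBSlots_subset _ hs
  obtain ⟨hm, -, -, -⟩ := mem_triSlots.1 hs'
  have hl := length_of_mem_triSL hωS
  -- the height range is unchanged by the insertion
  have hbot : triHgt (triIns m z ω) 0 = triHgt ω 0 := triHgt_triIns_of_le (Nat.zero_le m)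
  have htop : triHgt (triIns m z ω) ((triIns m z ω).length - 1) = triHgt ω (ω.length - 1) := by
    rw [length_triIns (by omega), hl, Nat.add_sub_cancel, Nat.add_sub_cancel,
      triHgt_triIns_of_lt (by omega : m + 1 < N + 1), Nat.add_sub_cancel]
  have hsplit := card_filter_add_card_filter_not (s := triBSlots ω)
    (p := fun p : ℕ × Site 2 => p.1 ≠ m ∧ p.2 ≠ z)
  have hA : #((triBSlots ω).filter fun p : ℕ × Site 2 => p.1 ≠ m ∧ p.2 ≠ z) ≤ #(triBSlots (triIns m z ω)) := by
    refine card_le_card_of_injOn (fun p : ℕ × Site 2 => if p.1 < m then p else (p.1 + 1, p.2)) ?_ ?_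
    · rintro ⟨j, u⟩ hp
      rw [mem_coe, mem_filter] at hp
      obtain ⟨hp, hjm, huz⟩ := hp
      obtain ⟨hp, hr1, hr2⟩ := mem_triBSlots.1 hp
      obtain ⟨hj, hp1, hp2, hp3⟩ := mem_triSlots.1 hp
      dsimp only at hjm huz hr1 hr2 ⊢
      have hu' : u ∉ triIns m z ω := by
        rw [mem_triIns (by omega)]
        push Not
        exact ⟨huz, hp3⟩
      rw [mem_coe, mem_triBSlots, hbot, htop]
      split_ifs with hlt
      · refine ⟨mem_triSlots.2 ⟨by rw [length_triIns (by omega)]; omega, ?_, ?_, hu'⟩, hr1, hr2⟩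
        · rw [getD_triIns_of_le hlt.le]; exact hp1
        · rw [getD_triIns_of_le (by omega)]; exact hp2
      · have hgt : m < j := lt_of_le_of_ne (not_lt.1 hlt) (Ne.symm hjm)
        refine ⟨mem_triSlots.2 ⟨by rw [length_triIns (by omega)]; omega, ?_, ?_, hu'⟩, hr1, hr2⟩
        · rw [getD_triIns_of_lt (by omega), Nat.add_sub_cancel]; exact hp1
        · rw [getD_triIns_of_lt (by omega), show j + 1 + 1 - 1 = j + 1 by omega]; exact hp2
    · rintro ⟨j₁, u₁⟩ hp₁ ⟨j₂, u₂⟩ hp₂ he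
      rw [mem_coe, mem_filter] at hp₁ hp₂
      dsimp only at he hp₁ hp₂
      split_ifs at he with ha hb hb
      · exact he
      · rw [Prod.mk.injEq] at he; omega
      · rw [Prod.mk.injEq] at he; omega
      · rw [Prod.mk.injEq] at he ⊢; exact ⟨by omega, he.2⟩
  have hB : #((triBSlots ω).filter fun p : ℕ × Site 2 => ¬(p.1 ≠ m ∧ p.2 ≠ z)) ≤ 8 := by
    have hsub : ((triBSlots ω).filter fun p : ℕ × Site 2 => ¬(p.1 ≠ m ∧ p.2 ≠ z)) ⊆
        ((triSlots ω).filter fun p : ℕ × Site 2 => p.1 = m) ∪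
          ((triSlots ω).filter fun p : ℕ × Site 2 => p.2 = z) := by
      intro p hp
      rw [mem_filter] at hp
      have hpS := triBSlots_subset _ hp.1
      rw [mem_union, mem_filter, mem_filter]
      by_cases hpm : p.1 = m
      · exact Or.inl ⟨hpS, hpm⟩
      · exact Or.inr ⟨hpS, by_contra fun h' => hp.2 ⟨hpm, h'⟩⟩
    have hE : #((triSlots ω).filter fun p : ℕ × Site 2 => p.1 = m) ≤ 2 := by
      calc _ ≤ #(((triGraph.neighborFinset (ω.getD m 0)).filter
              fun u => triGraph.Adj u (ω.getD (m + 1) 0)).image (Prod.mk m)) := by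
            refine card_le_card fun p hp => ?_
            obtain ⟨j, u⟩ := p
            rw [mem_filter] at hp
            obtain ⟨hp, hjm⟩ := hp
            dsimp only at hjm
            subst hjm
            obtain ⟨-, hp1, hp2, -⟩ := mem_triSlots.1 hp
            exact mem_image.2 ⟨u, mem_filter.2 ⟨(SimpleGraph.mem_neighborFinset _ _ _).2 hp1, hp2⟩, rfl⟩
        _ ≤ _ := card_image_le
        _ ≤ 2 := card_apex_le_two (adj_getD_of_mem_triSL hωS (by omega))
    have hR : #((triSlots ω).filter fun p : ℕ × Site 2 => p.2 = z) ≤ 6 := by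
      calc _ ≤ #(triGraph.neighborFinset z) := by
            refine card_le_card_of_injOn (fun p : ℕ × Site 2 => ω.getD p.1 0) ?_ ?_
            · rintro ⟨j, u⟩ hp
              rw [mem_coe, mem_filter] at hp
              obtain ⟨hp, huz⟩ := hp
              dsimp only at huz
              subst huz
              obtain ⟨-, hp1, -, -⟩ := mem_triSlots.1 hp
              rw [mem_coe, SimpleGraph.mem_neighborFinset]
              exact hp1.symm
            · rintro ⟨j₁, u₁⟩ hp₁ ⟨j₂, u₂⟩ hp₂ he
              rw [mem_coe, mem_filter] at hp₁ hp₂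
              obtain ⟨hj₁, -, -, -⟩ := mem_triSlots.1 hp₁.1
              obtain ⟨hj₂, -, -, -⟩ := mem_triSlots.1 hp₂.1
              dsimp only at he hp₁ hp₂
              have hj := getD_injOn_of_mem_triSL hωS (by omega) (by omega) he
              rw [Prod.mk.injEq]
              exact ⟨hj, hp₁.2.trans hp₂.2.symm⟩
        _ = 6 := card_neighborFinset_triGraph_holds z
    calc _ ≤ #(((triSlots ω).filter fun p : ℕ × Site 2 => p.1 = m) ∪
              ((triSlots ω).filter fun p : ℕ × Site 2 => p.2 = z)) := card_le_card hsub
      _ ≤ #((triSlots ω).filter fun p : ℕ × Site 2 => p.1 = m) +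
            #((triSlots ω).filter fun p : ℕ × Site 2 => p.2 = z) := card_union_le _ _
      _ ≤ 8 := by omega
  omega

/-! ### `b_N(𝕋) ≤ b_{N+1}(𝕋)` -/

/-- **`b_N(𝕋) ≤ b_{N+1}(𝕋)`**: concatenate the one-step bridge `(2,0)` with an `N`-step bridge
(`b_1 · b_N ≤ b_{N+1}`, `b_1 ≥ 1`). [cite: MadrasSlade1993, §1.2, eq. (1.2.15)] -/
theorem brickBridgeCount_le_succ (N : ℕ) : brickBridgeCount N ≤ brickBridgeCount (N + 1) := by
  have h := brickBridgeCount_mul_le 1 N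
  rw [Nat.add_comm] at h
  exact le_trans (Nat.le_mul_of_pos_left _ (one_le_brickBridgeCount 1)) h

/-- `#B_N(𝕋) ≤ #B_{N+1}(𝕋)`, list form. [cite: MadrasSlade1993, §1.2, eq. (1.2.15)] -/
theorem card_triBL_le_succ (N : ℕ) : #(triBL N) ≤ #(triBL (N + 1)) := by
  rw [card_triBL, card_triBL]; exact brickBridgeCount_le_succ N

end Literature.Probability.RandomPlanarGeometry.SAW
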